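import Literature.Analysis.FluidPDE.HardSphereFlowJointMeasurable
import Summits.AtomisticToContinuum.HydrodynamicLimit.Theorems.JParityClosureAssemblyEnergyModulus

/-!
# Route JParityClosure — `Assembly` (stmt-AtomisticToContinuum-17595): the windowed cubic-tail input
# of the energy modulus follows from fixed-time cubic tails (`EnergyCurrentTails`, stmt-9235)

The energy input `hequi_energy_localGibbs` of the fixed-time upgrade
(`JParityClosureAssemblyEnergyFixedTime.lean`) consumes a WINDOWED hypothesis `hcubic`:
`P_N{η < (N+1)⁻¹ ∫_t^{t+Δ} 𝒯³_M(Φ_r z) dr} ≤ κ` for large `N`, `𝒯³_M(z) = Σᵢ |vᵢ|³ 1{|vᵢ| > M}`. This file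
derives it from the FIXED-TIME-in-expectation form in which the shared crux `EnergyCurrentTails`
(stmt-AtomisticToContinuum-9235, wanted by eight routes) is typed,
`∀ s ∈ [0, t_c], E_N[(N+1)⁻¹ 𝒯³_M(Φ_s z)] ≤ e`, by Tonelli and Markov:

* `aemeasurable_cubicTail_uncurry` — joint a.e.-measurability of `(z, r) ↦ 𝒯³_M(Φ_r z)` for a law
  carried by the good set (from `HardSphereFlow.measurable_flow_prod_torus`, extension by `0`);
* `lintegral_cubicWindow_le` — `E_N[(N+1)⁻¹∫_t^{t+Δ} 𝒯³_M] ≤ e·Δ` (the window integral is an honest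
  Lebesgue integral along good orbits, `intervalIntegrable_cubicTail`; Tonelli);
* `measure_cubicWindow_le` — Markov: `P_N{η ≤ (N+1)⁻¹∫_t^{t+Δ} 𝒯³_M} ≤ e·Δ/η`;
* `hcubic_of_cubicTails_localGibbs` — in the frame of the conjunct, the inner statement of
  `EnergyCurrentTails` on `[0, t_c]` (`t < t_c`) gives verbatim the hypothesis `hcubic` of
  `hequi_energy_localGibbs` at `t`.

So of the two inputs the item's `X` lacks for the energy field at a fixed instant (gap G1), the
streaming one IS the shared crux 9235; only the collisional one (`EnergyJumpWindow`) is new. No new objects.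
-/

noncomputable section

namespace Summit.AtomisticToContinuum.HydrodynamicLimit.Theorems.JParityClosureEnergyModulus

open Set MeasureTheory Filter Topology Function
open scoped ENNReal
open Literature.Analysis.FluidPDE Literature.Analysis.FunctionSpaces
open Literature.MathematicalPhysics.KineticTheory

variable {d : Type*} [Fintype d]

/-- The cubic tail `𝒯³_M` is a measurable function of the configuration. [folklore] -/
theorem measurable_cubicTail {X : Type*} [MeasurableSpace X] {N : ℕ} (M : ℝ) :
    Measurable fun z : Config N d X =>
      ∑ i, {w : EuclideanSpace ℝ d | M < ‖w‖}.indicator (fun w => ‖w‖ ^ 3) (z i).2 := by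
  refine Finset.measurable_sum _ fun i _ => ?_
  have hS : MeasurableSet {w : EuclideanSpace ℝ d | M < ‖w‖} :=
    measurableSet_lt measurable_const measurable_norm
  exact ((measurable_norm.pow_const 3).indicator hS).comp ((measurable_pi_apply i).snd)

/-- **Joint a.e.-measurability of the cubic tail along the flow.** For a law `P` carried by the good set
of a hard-sphere flow on `𝕋ᵈ` and any measure `ν` on `ℝ`, `(z, r) ↦ m⁻¹ 𝒯³_M(Φ_r z)` (as `ℝ≥0∞`) is
a.e.-measurable for `P ⊗ ν`: on `good × ℝ` it is measurable (`measurable_flow_prod_torus`), and the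
complement is `P ⊗ ν`-null. [folklore] -/
theorem aemeasurable_cubicTail_uncurry {ε : ℝ} {N : ℕ} (Φ : HardSphereFlow (Torus.geometry d) ε N)
    (P : Measure (Config N d (UnitAddTorus d))) (hP : P Φ.goodᶜ = 0) (ν : Measure ℝ) [SFinite ν]
    (M m : ℝ) :
    AEMeasurable (fun p : Config N d (UnitAddTorus d) × ℝ => ENNReal.ofReal (m⁻¹ *
      ∑ i, {w : EuclideanSpace ℝ d | M < ‖w‖}.indicator (fun w => ‖w‖ ^ 3) (Φ.flow p.2 p.1 i).2))
      (P.prod ν) := by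
  classical
  set T : Config N d (UnitAddTorus d) → ℝ := fun z =>
    ∑ i, {w : EuclideanSpace ℝ d | M < ‖w‖}.indicator (fun w => ‖w‖ ^ 3) (z i).2 with hT
  have hTm : Measurable T := measurable_cubicTail M
  -- the measurable modification: extend by `0` off the good set
  have hflow : Measurable fun q : Φ.good × ℝ => Φ.flow q.2 (q.1 : Config N d (UnitAddTorus d)) :=
    Φ.measurable_flow_prod_torus
  set s : Set (Config N d (UnitAddTorus d) × ℝ) := Prod.fst ⁻¹' Φ.good with hs
  have hsm : MeasurableSet s := measurable_fst Φ.measurableSet_good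
  have hf : Measurable fun q : s => ENNReal.ofReal (m⁻¹ * T (Φ.flow q.1.2 q.1.1)) := by
    have h1 : Measurable fun q : s => (⟨(⟨q.1.1, q.2⟩ : Φ.good), q.1.2⟩ : Φ.good × ℝ) :=
      (measurable_subtype_coe.fst.subtype_mk).prodMk measurable_subtype_coe.snd
    exact ENNReal.measurable_ofReal.comp ((hTm.comp (hflow.comp h1)).const_mul _)
  have hF : Measurable fun p : Config N d (UnitAddTorus d) × ℝ =>
      if hp : p ∈ s then ENNReal.ofReal (m⁻¹ * T (Φ.flow p.2 p.1)) else 0 :=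
    Measurable.dite hf measurable_const hsm
  refine ⟨_, hF, ?_⟩
  have hnull : (P.prod ν) sᶜ = 0 := by
    have : sᶜ = Φ.goodᶜ ×ˢ (univ : Set ℝ) := by
      ext p; simp [hs]
    rw [this, Measure.prod_prod, hP, zero_mul]
  have hae : ∀ᵐ p ∂(P.prod ν), p ∈ s := by
    have := compl_mem_ae_iff.2 hnull
    rwa [compl_compl] at this
  filter_upwards [hae] with p hp
  simp only [dif_pos hp, hT]

/-- **Expectation of the windowed cubic tail** (Tonelli): for a law `P` carried by the good set, `m > 0`,
`t ≤ t + Δ`, if `E[m⁻¹𝒯³_M(Φ_s z)] ≤ e` for all `s ∈ [t, t + Δ]` then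
`E[m⁻¹ ∫_t^{t+Δ} 𝒯³_M(Φ_r z) dr] ≤ e · Δ` (as `ℝ≥0∞`). [folklore] -/
theorem lintegral_cubicWindow_le {ε : ℝ} {N : ℕ} (Φ : HardSphereFlow (Torus.geometry d) ε N)
    (P : Measure (Config N d (UnitAddTorus d))) [SFinite P] (hP : P Φ.goodᶜ = 0) (M : ℝ) {m : ℝ}
    (hm : 0 < m) {t Δ : ℝ} (hΔ : 0 ≤ Δ) {e : ℝ}
    (htail : ∀ s ∈ Icc t (t + Δ), ∫⁻ z, ENNReal.ofReal (m⁻¹ *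
      ∑ i, {w : EuclideanSpace ℝ d | M < ‖w‖}.indicator (fun w => ‖w‖ ^ 3) (Φ.flow s z i).2) ∂P ≤
      ENNReal.ofReal e) :
    ∫⁻ z, ENNReal.ofReal (m⁻¹ * ∫ r in t..(t + Δ),
        ∑ i, {w : EuclideanSpace ℝ d | M < ‖w‖}.indicator (fun w => ‖w‖ ^ 3) (Φ.flow r z i).2) ∂P ≤
      ENNReal.ofReal e * ENNReal.ofReal Δ := by
  set T : Config N d (UnitAddTorus d) → ℝ := fun z =>
    ∑ i, {w : EuclideanSpace ℝ d | M < ‖w‖}.indicator (fun w => ‖w‖ ^ 3) (z i).2 with hT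
  have hT0 : ∀ z, 0 ≤ T z := fun z =>
    Finset.sum_nonneg fun i _ => indicator_nonneg (fun w _ => by positivity) _
  have hae : ∀ᵐ z ∂P, z ∈ Φ.good := by
    have := compl_mem_ae_iff.2 hP
    rwa [compl_compl] at this
  -- along good orbits the window integral is a Lebesgue integral of a nonnegative function
  have hpt : ∀ᵐ z ∂P, ENNReal.ofReal (m⁻¹ * ∫ r in t..(t + Δ), T (Φ.flow r z)) =
      ∫⁻ r in Ioc t (t + Δ), ENNReal.ofReal (m⁻¹ * T (Φ.flow r z)) := by
    filter_upwards [hae] with z hz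
    have hint : IntegrableOn (fun r => T (Φ.flow r z)) (Ioc t (t + Δ)) :=
      (intervalIntegrable_cubicTail (Φ.isTrajectory z hz) M (by linarith : t ≤ t + Δ)).1
    rw [intervalIntegral.integral_of_le (by linarith), ← integral_const_mul,
      ofReal_integral_eq_lintegral_ofReal (hint.const_mul _)
        (ae_of_all _ fun r => mul_nonneg (inv_pos.2 hm).le (hT0 _))]
  rw [lintegral_congr_ae hpt]
  -- Tonelli
  have hsw := lintegral_lintegral_swap (μ := P) (ν := volume.restrict (Ioc t (t + Δ)))
    (f := fun z r => ENNReal.ofReal (m⁻¹ * T (Φ.flow r z)))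
    (aemeasurable_cubicTail_uncurry Φ P hP _ M m)
  rw [hsw]
  calc ∫⁻ r in Ioc t (t + Δ), ∫⁻ z, ENNReal.ofReal (m⁻¹ * T (Φ.flow r z)) ∂P
      ≤ ∫⁻ _r in Ioc t (t + Δ), ENNReal.ofReal e :=
        setLIntegral_mono' measurableSet_Ioc fun r hr => htail r ⟨hr.1.le, hr.2⟩
    _ = ENNReal.ofReal e * ENNReal.ofReal Δ := by
        rw [setLIntegral_const, Real.volume_Ioc, add_sub_cancel_left]

/-- **Markov for the windowed cubic tail**: under the hypotheses of `lintegral_cubicWindow_le` and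
`η > 0`, `P{η ≤ m⁻¹∫_t^{t+Δ} 𝒯³_M} ≤ e·Δ/η`. [folklore] -/
theorem measure_cubicWindow_le {ε : ℝ} {N : ℕ} (Φ : HardSphereFlow (Torus.geometry d) ε N)
    (P : Measure (Config N d (UnitAddTorus d))) [SFinite P] (hP : P Φ.goodᶜ = 0) (M : ℝ) {m : ℝ}
    (hm : 0 < m) {t Δ : ℝ} (hΔ : 0 ≤ Δ) {e : ℝ} (he : 0 ≤ e)
    (htail : ∀ s ∈ Icc t (t + Δ), ∫⁻ z, ENNReal.ofReal (m⁻¹ *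
      ∑ i, {w : EuclideanSpace ℝ d | M < ‖w‖}.indicator (fun w => ‖w‖ ^ 3) (Φ.flow s z i).2) ∂P ≤
      ENNReal.ofReal e) {η : ℝ} (hη : 0 < η) :
    P {z | η ≤ m⁻¹ * ∫ r in t..(t + Δ),
        ∑ i, {w : EuclideanSpace ℝ d | M < ‖w‖}.indicator (fun w => ‖w‖ ^ 3) (Φ.flow r z i).2} ≤
      ENNReal.ofReal (e * Δ / η) := by
  set X : Config N d (UnitAddTorus d) → ℝ := fun z => m⁻¹ * ∫ r in t..(t + Δ),
    ∑ i, {w : EuclideanSpace ℝ d | M < ‖w‖}.indicator (fun w => ‖w‖ ^ 3) (Φ.flow r z i).2 with hX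
  have hXm : AEMeasurable (fun z => ENNReal.ofReal (X z)) P :=
    ((Φ.aemeasurable_intervalIntegral_comp_flow_torus (measurable_cubicTail M) t (t + Δ) hP).const_mul
      _).ennreal_ofReal
  have hsub : {z | η ≤ X z} ⊆ {z | ENNReal.ofReal η ≤ ENNReal.ofReal (X z)} := fun z hz =>
    ENNReal.ofReal_le_ofReal hz
  calc P {z | η ≤ X z} ≤ P {z | ENNReal.ofReal η ≤ ENNReal.ofReal (X z)} := measure_mono hsub
    _ ≤ (∫⁻ z, ENNReal.ofReal (X z) ∂P) / ENNReal.ofReal η :=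
        meas_ge_le_lintegral_div hXm (by simpa using hη) ENNReal.ofReal_ne_top
    _ ≤ ENNReal.ofReal e * ENNReal.ofReal Δ / ENNReal.ofReal η := by
        gcongr
        exact lintegral_cubicWindow_le Φ P hP M hm hΔ htail
    _ = ENNReal.ofReal (e * Δ / η) := by
        rw [← ENNReal.ofReal_mul he, ENNReal.ofReal_div_of_pos hη]

/-- **`hcubic` from the inner statement of `EnergyCurrentTails`** (stmt-AtomisticToContinuum-9235) in the
frame of the conjunct: if for some `t_c > t` (both in the classical window) the fixed-time cubic tails are
small in expectation uniformly on `[0, t_c]` —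
`∀ e > 0 ∃ M ∃ N₀ ∀ N ≥ N₀ ∀ s ∈ [0, t_c], E_N[(N+1)⁻¹ Σᵢ |vᵢ(s)|³ 1{|vᵢ(s)| > M}] ≤ e` — then verbatim
the hypothesis `hcubic` of `hequi_energy_localGibbs` at `t` holds (window `Δ = t_c − t`, level
`max M 0`, `e = ηκ/Δ`; `measure_cubicWindow_le`). [folklore] -/
theorem hcubic_of_cubicTails_localGibbs (σ : ℝ) (a₀ θ₀ : T3 → ℝ) (u₀ : T3 → V3)
    (Φ : (N : ℕ) → HardSphereFlow (Torus.geometry (Fin 3)) (hsDiameter σ N) (N + 1))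
    {t t_c : ℝ} (ht : 0 ≤ t) (httc : t < t_c)
    (htails : ∀ e : ℝ, 0 < e → ∃ M : ℝ, ∃ N₀ : ℕ, ∀ N : ℕ, N₀ ≤ N → ∀ s ∈ Icc 0 t_c,
      ∫⁻ z, ENNReal.ofReal (((N : ℝ) + 1)⁻¹ * ∑ i : Fin (N + 1),
        {v : V3 | M < ‖v‖}.indicator (fun v => ‖v‖ ^ 3) (((Φ N).flow s z i).2))
          ∂(localGibbsLaw σ a₀ u₀ θ₀ N (Φ N)) ≤ ENNReal.ofReal e) :
    ∀ η : ℝ, 0 < η → ∀ κ : ℝ, 0 < κ → ∃ M : ℝ, 0 ≤ M ∧ ∃ Δ : ℝ, 0 < Δ ∧ ∃ N₂ : ℕ,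
      ∀ N, N₂ ≤ N → localGibbsLaw σ a₀ u₀ θ₀ N (Φ N) {z | η < ((N : ℝ) + 1)⁻¹ *
        ∫ r in t..(t + Δ), ∑ i, {w : V3 | M < ‖w‖}.indicator (fun w => ‖w‖ ^ 3)
          ((Φ N).flow r z i).2} ≤ ENNReal.ofReal κ := by
  intro η hη κ hκ
  set Δ : ℝ := t_c - t with hΔdef
  have hΔ : 0 < Δ := by rw [hΔdef]; linarith
  obtain ⟨M, N₀, hM⟩ := htails (η * κ / Δ) (by positivity)
  refine ⟨max M 0, le_max_right _ _, Δ, hΔ, N₀, fun N hN => ?_⟩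
  haveI : SigmaFinite (volume : Measure (T3 × V3)) := inferInstance
  haveI : SigmaFinite (volume : Measure (Config (N + 1) (Fin 3) T3)) := inferInstance
  haveI : SFinite (localGibbsLaw σ a₀ u₀ θ₀ N (Φ N)) := by
    rw [localGibbsLaw, particleLaw_eq]; unfold liouville; infer_instance
  -- raising the level only lowers the tail
  have hsubset : {w : V3 | max M 0 < ‖w‖} ⊆ {w : V3 | M < ‖w‖} := fun w hw =>
    lt_of_le_of_lt (le_max_left M 0) hw
  have hmono : ∀ v : V3, {w : V3 | max M 0 < ‖w‖}.indicator (fun w => ‖w‖ ^ 3) v ≤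
      {w : V3 | M < ‖w‖}.indicator (fun w => ‖w‖ ^ 3) v := fun v =>
    indicator_le_indicator_of_subset hsubset (fun w => by positivity) v
  have htail' : ∀ s ∈ Icc t (t + Δ), ∫⁻ z, ENNReal.ofReal (((N : ℝ) + 1)⁻¹ * ∑ i : Fin (N + 1),
      {w : V3 | max M 0 < ‖w‖}.indicator (fun w => ‖w‖ ^ 3) (((Φ N).flow s z i).2))
        ∂(localGibbsLaw σ a₀ u₀ θ₀ N (Φ N)) ≤ ENNReal.ofReal (η * κ / Δ) := by
    intro s hs
    refine le_trans (lintegral_mono fun z => ENNReal.ofReal_le_ofReal ?_)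
      (hM N hN s ⟨ht.trans hs.1, by rw [hΔdef] at hs; linarith [hs.2]⟩)
    exact mul_le_mul_of_nonneg_left (Finset.sum_le_sum fun i _ => hmono _) (by positivity)
  have key := measure_cubicWindow_le (Φ N) (localGibbsLaw σ a₀ u₀ θ₀ N (Φ N))
    (localGibbsLaw_compl_good σ a₀ θ₀ u₀ N (Φ N)) (max M 0) (m := (N : ℝ) + 1) (by positivity) hΔ.le
    (by positivity : (0 : ℝ) ≤ η * κ / Δ) htail' hη
  have harith : η * κ / Δ * Δ / η = κ := by field_simp
  rw [harith] at key
  refine le_trans (measure_mono ?_) key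
  intro z hz
  rw [mem_setOf_eq] at hz ⊢
  exact le_of_lt hz

end Summit.AtomisticToContinuum.HydrodynamicLimit.Theorems.JParityClosureEnergyModulus

end
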